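import Summits.CriticalPhenomena.PercolationContinuityZ3.Theorems.PercNearOneGluingNoHeavyLowerTailKNGoodGMgcGrandchild
import Summits.CriticalPhenomena.PercolationContinuityZ3.Theorems.PercNearOneGluingNoHeavyLowerTailKNGoodGCThreeMultiAssembly
import Summits.CriticalPhenomena.PercolationContinuityZ3.Theorems.PercNearOneGluingNoHeavyLowerTailKNGoodSeriesGlue
import HarnessLib

/-!
# The observer with THREE children (|A| = 3): goodness reduced to the all-children blob kernel
# (`NoHeavyLowerTail` cell, stmt-CriticalPhenomena-4575; prover `prim-hp-2`, gen 19 — step S5 of MEMO-gen15 §3a / MEMO-gen19 §6)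

Support file (`--supports stmt-CriticalPhenomena-4575`; imports the COMPUTATIONAL `…KNGoodGMgcGrandchild`).  No definitions, no named facts,
no sorries.  The last observer side of ≤ 4 vertices not yet covered by a tree theorem is `o` joined to ALL of `x, y, z` (any pairs among
them, any hairs, any core).  Kozma–Nitzan's star peeling (`KNGoodBranching.knGood_of_starNeed`, witness `a₀ = argmin_{G∖o}`) asks, for each
nonempty `B ⊆ {x,y,z}`, for the star inequality NEED(B); conditioning on the star `σ_B` is FORCING (`real_inter_starEvent_eq_mul_forced`), so
NEED(B) follows from nonnegativity of the goodness functional of `o` at `a₀` in the FORCED graph `W_B` (pairs `o–B` sure, the other pairs at `o`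
closed) — pockets compared by locality.  This file discharges `|B| = 1` (corner (1,0) `agood_wzero_glue_one` + goodness of the child in `G∖o`,
`KNGoodGC3Adj.knGood_twoChildren_threeRelays`) and `|B| = 2` (corner (1,1) `agood_wzero_glue_two` + THEOREM B `KNGoodGMgc.gm_grandchild_row` with
the third child as the grandchild) and ISOLATES `|B| = 3` as the explicit hypothesis `hkey3` (the "blob kernel": `o` glued to all three children;
MEMO-gen19 §6 gives the intended proof via the inner-pair mixture and `agood_forced_multi_sorted`):
* `KNGoodGMgc.forced_key_one`, `KNGoodGMgc.forced_key_two` — the forced functionals for `|B| = 1, 2` are nonnegative;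
* **`KNGoodGMgc.knGood_threeChildren_of_blobKey`** — `KNGood w A hA o b` for the three-children observer, given the blob kernel at the
  `G∖o`-loneliest relay.
-/

noncomputable section

namespace Summit.CriticalPhenomena.PercolationContinuityZ3.Theorems

namespace KNGoodGMgc

open MeasureTheory Set Literature.Probability.LatticeModels Literature.Probability.Percolation KNGoodAux KNGoodHair KNGoodSeries
  KNGoodGC3 KNGoodGC3Adj KNSep KNGoodBranching UpsetExchange RelayNbhd
open scoped Classical BigOperators

variable {n : ℕ}

/-! ## The forced graphs as updates of `G − o` -/

/-- The forced graph of the star `{x}` is `(G − o)[ox ↦ 1]`. [this work] -/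
theorem forced_eq_update_one (w : Sym2 (Fin n) → unitInterval) (o x : Fin n) (hloop : w s(o, o) = 0) :
    (fun e : Sym2 (Fin n) => if o ∈ e then (if ∃ p ∈ ({x} : Finset (Fin n)), e = s(o, p) then 1 else 0) else w e) =
      Function.update (pinW w {e : Sym2 (Fin n) | o ∈ e ∧ ¬ e.IsDiag} ∅) s(o, x) 1 := by
  funext e
  by_cases hex : e = s(o, x)
  · subst hex; simp
  rw [Function.update_of_ne hex]
  by_cases hoe : o ∈ e
  · simp only [hoe, if_true, Finset.mem_singleton, exists_eq_left, hex, if_false]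
    by_cases hd : e.IsDiag
    · have : e = s(o, o) := by
        induction e using Sym2.ind with
        | h p q =>
          have hpq : p = q := Sym2.mk_isDiag_iff.1 hd
          subst hpq
          rcases Sym2.mem_iff.1 hoe with rfl | rfl <;> rfl
      rw [this, pinW_apply_of_not_mem w ∅ (fun h => h.2 (by simp)), hloop]
    · exact (pinW_apply_of_mem_of_not_mem w (F := {e : Sym2 (Fin n) | o ∈ e ∧ ¬ e.IsDiag}) ⟨hoe, hd⟩ (Set.notMem_empty _)).symm
  · simp only [hoe, if_false]
    exact (pinW_apply_of_not_mem w ∅ (fun h => hoe h.1)).symm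

/-- The forced graph of the star `{x, y}` is `(G − o)[ox ↦ 1][oy ↦ 1]`. [this work] -/
theorem forced_eq_update_two (w : Sym2 (Fin n) → unitInterval) (o x y : Fin n) (hxo : x ≠ o) (hyo : y ≠ o) (hloop : w s(o, o) = 0) :
    (fun e : Sym2 (Fin n) => if o ∈ e then (if ∃ p ∈ ({x, y} : Finset (Fin n)), e = s(o, p) then 1 else 0) else w e) =
      Function.update (Function.update (pinW w {e : Sym2 (Fin n) | o ∈ e ∧ ¬ e.IsDiag} ∅) s(o, x) 1) s(o, y) 1 := by
  funext e
  by_cases hey : e = s(o, y)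
  · subst hey; simp
  rw [Function.update_of_ne hey]
  by_cases hex : e = s(o, x)
  · subst hex; simp
  rw [Function.update_of_ne hex]
  by_cases hoe : o ∈ e
  · have hno : ¬∃ p ∈ ({x, y} : Finset (Fin n)), e = s(o, p) := by
      rintro ⟨p, hp, rfl⟩
      simp only [Finset.mem_insert, Finset.mem_singleton] at hp
      rcases hp with rfl | rfl
      · exact hex rfl
      · exact hey rfl
    simp only [hoe, if_true, hno, if_false]
    by_cases hd : e.IsDiag
    · have : e = s(o, o) := by
        induction e using Sym2.ind with
        | h p q =>
          have hpq : p = q := Sym2.mk_isDiag_iff.1 hd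
          subst hpq
          rcases Sym2.mem_iff.1 hoe with rfl | rfl <;> rfl
      rw [this, pinW_apply_of_not_mem w ∅ (fun h => h.2 (by simp)), hloop]
    · exact (pinW_apply_of_mem_of_not_mem w (F := {e : Sym2 (Fin n) | o ∈ e ∧ ¬ e.IsDiag}) ⟨hoe, hd⟩ (Set.notMem_empty _)).symm
  · simp only [hoe, if_false]
    exact (pinW_apply_of_not_mem w ∅ (fun h => hoe h.1)).symm

/-! ## The forced functionals for the small stars -/

/-- In `G − o` the three children carry pairs only to the relays and to each other. [this work] -/
theorem pendant_wzero (w : Sym2 (Fin n) → unitInterval) (A : Finset (Fin n)) (o x y z : Fin n) (hxo : x ≠ o) (hyo : y ≠ o) (hzo : z ≠ o)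
    (hxN : ∀ t : Fin n, t ∉ A → t ≠ o → t ≠ y → t ≠ z → w s(x, t) = 0)
    (hyN : ∀ t : Fin n, t ∉ A → t ≠ o → t ≠ x → t ≠ z → w s(y, t) = 0)
    (hzN : ∀ t : Fin n, t ∉ A → t ≠ o → t ≠ x → t ≠ y → w s(z, t) = 0) :
    (∀ t : Fin n, t ∉ A → t ≠ y → t ≠ z → (pinW w {e : Sym2 (Fin n) | o ∈ e ∧ ¬ e.IsDiag} ∅) s(x, t) = 0) ∧
    (∀ t : Fin n, t ∉ A → t ≠ x → t ≠ z → (pinW w {e : Sym2 (Fin n) | o ∈ e ∧ ¬ e.IsDiag} ∅) s(y, t) = 0) ∧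
    (∀ t : Fin n, t ∉ A → t ≠ x → t ≠ y → (pinW w {e : Sym2 (Fin n) | o ∈ e ∧ ¬ e.IsDiag} ∅) s(z, t) = 0) := by
  have hoff : ∀ c d : Fin n, c ≠ o → d ≠ o → (pinW w {e : Sym2 (Fin n) | o ∈ e ∧ ¬ e.IsDiag} ∅) s(c, d) = w s(c, d) := by
    intro c d hc hd
    refine pinW_apply_of_not_mem w ∅ ?_
    rintro ⟨hoe, -⟩
    rcases Sym2.mem_iff.1 hoe with h | h
    · exact hc h.symm
    · exact hd h.symm
  have hto : ∀ v : Fin n, v ≠ o → (pinW w {e : Sym2 (Fin n) | o ∈ e ∧ ¬ e.IsDiag} ∅) s(v, o) = 0 := by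
    intro v hv; rw [Sym2.eq_swap]; exact pinW_star_mk w hv
  refine ⟨fun t htA hty htz => ?_, fun t htA htx htz => ?_, fun t htA htx hty => ?_⟩
  · by_cases hto' : t = o
    · rw [hto']; exact hto x hxo
    · rw [hoff x t hxo hto']; exact hxN t htA hto' hty htz
  · by_cases hto' : t = o
    · rw [hto']; exact hto y hyo
    · rw [hoff y t hyo hto']; exact hyN t htA hto' htx htz
  · by_cases hto' : t = o
    · rw [hto']; exact hto z hzo
    · rw [hoff z t hzo hto']; exact hzN t htA hto' htx hty

/-- **`|B| = 1`**: the forced functional of the star `{x}` at `a₀` is nonnegative (corner (1,0) + goodness of `x` in `G − o`). [this work] -/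
theorem forced_key_one (w : Sym2 (Fin n) → unitInterval) (A : Finset (Fin n)) (hA : A.Nonempty)
    (o x y z b a₁ a₂ a₃ a₀ : Fin n) (hAeq : A = {a₁, a₂, a₃}) (h12 : a₁ ≠ a₂) (h13 : a₁ ≠ a₃) (h23 : a₂ ≠ a₃)
    (ho : o ∉ A) (hx : x ∉ A) (hy : y ∉ A) (hz : z ∉ A) (hxo : x ≠ o) (hyo : y ≠ o) (hzo : z ≠ o) (hxy : x ≠ y) (hxz : x ≠ z)
    (hyz : y ≠ z) (hbo : b ≠ o) (hbx : b ≠ x) (hby : b ≠ y) (hbz : b ≠ z) (ha₀ : a₀ ∈ A)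
    (hxN : ∀ t : Fin n, t ∉ A → t ≠ o → t ≠ y → t ≠ z → w s(x, t) = 0)
    (hyN : ∀ t : Fin n, t ∉ A → t ≠ o → t ≠ x → t ≠ z → w s(y, t) = 0)
    (hzN : ∀ t : Fin n, t ∉ A → t ≠ o → t ≠ x → t ≠ y → w s(z, t) = 0)
    (hmin0 : ∀ a ∈ A, (prodBernoulli (pinW w {e : Sym2 (Fin n) | o ∈ e ∧ ¬ e.IsDiag} ∅)).real (openConn a₀ b) ≤
      (prodBernoulli (pinW w {e : Sym2 (Fin n) | o ∈ e ∧ ¬ e.IsDiag} ∅)).real (openConn a b)) :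
    (prodBernoulli (Function.update (pinW w {e : Sym2 (Fin n) | o ∈ e ∧ ¬ e.IsDiag} ∅) s(o, x) 1)).real (openConn a₀ b) ≤
      (prodBernoulli (Function.update (pinW w {e : Sym2 (Fin n) | o ∈ e ∧ ¬ e.IsDiag} ∅) s(o, x) 1)).real (openConn o b) +
        ∑ W ∈ nullSets A,
          (prodBernoulli (Function.update (pinW w {e : Sym2 (Fin n) | o ∈ e ∧ ¬ e.IsDiag} ∅) s(o, x) 1)).real (clusterIs o W) *
          A.inf' hA (fun a' => (prodBernoulli (Function.update (pinW w {e : Sym2 (Fin n) | o ∈ e ∧ ¬ e.IsDiag} ∅) s(o, x) 1)).real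
            (openConnIn ((↑W : Set (Fin n))ᶜ) a' b)) := by
  set w0 := pinW w {e : Sym2 (Fin n) | o ∈ e ∧ ¬ e.IsDiag} ∅ with hw0
  obtain ⟨hxN0, hyN0, hzN0⟩ := pendant_wzero w A o x y z hxo hyo hzo hxN hyN hzN
  have hgood : KNGood w0 A hA x b :=
    knGood_twoChildren_threeRelays w0 A hA x y z b a₁ a₂ a₃ hAeq h12 h13 h23 hx hy hz (Ne.symm hxy) (Ne.symm hxz) hyz hbx hby hbz
      (fun v _ hvA hvy hvz => hxN0 v hvA hvy hvz) (fun t htA htx htz => hyN0 t htA htx htz) (fun t htA htx hty => hzN0 t htA htx hty)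
  have hinf : A.inf' hA (fun a => (prodBernoulli w0).real (openConn a b)) = (prodBernoulli w0).real (openConn a₀ b) :=
    le_antisymm (Finset.inf'_le _ ha₀) ((Finset.le_inf'_iff hA _).2 hmin0)
  have e := agood_wzero_glue_one w A hA o x a₀ b ho hxo ha₀ hbo
  rw [KNGood, hinf] at hgood
  rw [← hw0] at e
  linarith [hgood, e]

/-- **`|B| = 2`**: the forced functional of the star `{x, y}` at `a₀` is nonnegative (corner (1,1) + THEOREM B with grandchild `z`).
[this work] -/
theorem forced_key_two (w : Sym2 (Fin n) → unitInterval) (A : Finset (Fin n)) (hA : A.Nonempty)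
    (o x y z b a₁ a₂ a₃ a₀ : Fin n) (hAeq : A = {a₁, a₂, a₃}) (h12 : a₁ ≠ a₂) (h13 : a₁ ≠ a₃) (h23 : a₂ ≠ a₃)
    (ho : o ∉ A) (hx : x ∉ A) (hy : y ∉ A) (hz : z ∉ A) (hxo : x ≠ o) (hyo : y ≠ o) (hzo : z ≠ o) (hxy : x ≠ y) (hxz : x ≠ z)
    (hyz : y ≠ z) (hbo : b ≠ o) (hbx : b ≠ x) (hby : b ≠ y) (hbz : b ≠ z) (ha₀ : a₀ ∈ A)
    (hxN : ∀ t : Fin n, t ∉ A → t ≠ o → t ≠ y → t ≠ z → w s(x, t) = 0)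
    (hyN : ∀ t : Fin n, t ∉ A → t ≠ o → t ≠ x → t ≠ z → w s(y, t) = 0)
    (hzN : ∀ t : Fin n, t ∉ A → t ≠ o → t ≠ x → t ≠ y → w s(z, t) = 0)
    (hmin0 : ∀ a ∈ A, (prodBernoulli (pinW w {e : Sym2 (Fin n) | o ∈ e ∧ ¬ e.IsDiag} ∅)).real (openConn a₀ b) ≤
      (prodBernoulli (pinW w {e : Sym2 (Fin n) | o ∈ e ∧ ¬ e.IsDiag} ∅)).real (openConn a b)) :
    (prodBernoulli (Function.update (Function.update (pinW w {e : Sym2 (Fin n) | o ∈ e ∧ ¬ e.IsDiag} ∅) s(o, x) 1) s(o, y) 1)).real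
        (openConn a₀ b) ≤
      (prodBernoulli (Function.update (Function.update (pinW w {e : Sym2 (Fin n) | o ∈ e ∧ ¬ e.IsDiag} ∅) s(o, x) 1) s(o, y) 1)).real
          (openConn o b) +
        ∑ W ∈ nullSets A,
          (prodBernoulli (Function.update (Function.update (pinW w {e : Sym2 (Fin n) | o ∈ e ∧ ¬ e.IsDiag} ∅) s(o, x) 1) s(o, y) 1)).real
            (clusterIs o W) *
          A.inf' hA (fun a' => (prodBernoulli (Function.update (Function.update
            (pinW w {e : Sym2 (Fin n) | o ∈ e ∧ ¬ e.IsDiag} ∅) s(o, x) 1) s(o, y) 1)).real (openConnIn ((↑W : Set (Fin n))ᶜ) a' b)) := by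
  set w0 := pinW w {e : Sym2 (Fin n) | o ∈ e ∧ ¬ e.IsDiag} ∅ with hw0
  obtain ⟨hxN0, hyN0, hzN0⟩ := pendant_wzero w A o x y z hxo hyo hzo hxN hyN hzN
  -- sort the relays by their reliability in the core
  set K : Sym2 (Fin n) → unitInterval := fun e => if x ∈ e then 0 else if y ∈ e then 0 else if z ∈ e then 0 else w0 e with hK
  obtain ⟨b₁, b₂, b₃, hP, hb12, hb13, hb23, hs12, hs23⟩ :=
    exists_sorted_three (fun a => (prodBernoulli K).real (openConn a b)) a₁ a₂ a₃ h12 h13 h23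
  have hAeq' : A = {b₁, b₂, b₃} := hAeq.trans hP
  have hGC := gm_grandchild_row w0 A hA x y z b b₁ b₂ b₃ a₀ hAeq' hb12 hb13 hb23 hxy hxz hyz hx hy hz hbx hby hbz ha₀ hxN0 hyN0 hzN0
    K hK hs12 hs23 hmin0
  have e := agood_wzero_glue_two w A hA o x y a₀ b ho hxo hyo hxy ha₀ hbo
  rw [← hw0] at e
  linarith [hGC, e]

/-- The nonempty subsets of a three-element set. [folklore] -/
theorem subset_three_cases {x y z : Fin n} (B : Finset (Fin n)) (hB : B ⊆ {x, y, z}) (hne : B.Nonempty) :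
    B = {x} ∨ B = {y} ∨ B = {z} ∨ B = {x, y} ∨ B = {x, z} ∨ B = {y, z} ∨ B = {x, y, z} := by
  have hmem : ∀ t ∈ B, t = x ∨ t = y ∨ t = z := fun t ht => by simpa using hB ht
  have key : B = ({x, y, z} : Finset (Fin n)).filter (· ∈ B) := by
    ext t; simp only [Finset.mem_filter, Finset.mem_insert, Finset.mem_singleton]
    exact ⟨fun h => ⟨hmem t h, h⟩, fun h => h.2⟩
  by_cases hxB : x ∈ B <;> by_cases hyB : y ∈ B <;> by_cases hzB : z ∈ B <;>
    first
    | (exfalso; obtain ⟨t, ht⟩ := hne; rcases hmem t ht with rfl | rfl | rfl <;> contradiction)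
    | (rw [key]; simp [Finset.filter_insert, Finset.filter_singleton, hxB, hyB, hzB])

/-! ## The three-children observer -/

/-- **Goodness of the observer with three children, given the blob kernel.**  `o, x, y, z ∉ A = {a₁,a₂,a₃}` distinct; the pairs at `o` go to
`A ∪ {x,y,z}`, at `x` to `A ∪ {o,y,z}`, at `y` to `A ∪ {o,x,z}`, at `z` to `A ∪ {o,x,y}` (all weights arbitrary; the loop at `o` is `0`);
`b ∉ {o,x,y,z}`.  Hypothesis `hkey3` (the BLOB KERNEL, MEMO-gen19 §6): for the `G∖o`-loneliest relay `a₀`, the goodness functional of `o` in the graph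
with `o` SURELY glued to all three children is nonnegative at `a₀`.  Then `KNGood w A hA o b`. [this work] -/
theorem knGood_threeChildren_of_blobKey (w : Sym2 (Fin n) → unitInterval) (A : Finset (Fin n)) (hA : A.Nonempty)
    (o x y z b a₁ a₂ a₃ : Fin n) (hAeq : A = {a₁, a₂, a₃}) (h12 : a₁ ≠ a₂) (h13 : a₁ ≠ a₃) (h23 : a₂ ≠ a₃)
    (ho : o ∉ A) (hx : x ∉ A) (hy : y ∉ A) (hz : z ∉ A) (hxo : x ≠ o) (hyo : y ≠ o) (hzo : z ≠ o) (hxy : x ≠ y) (hxz : x ≠ z)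
    (hyz : y ≠ z) (hbo : b ≠ o) (hbx : b ≠ x) (hby : b ≠ y) (hbz : b ≠ z) (hloop : w s(o, o) = 0)
    (hoN : ∀ v : Fin n, v ≠ o → v ∉ A → v ≠ x → v ≠ y → v ≠ z → w s(o, v) = 0)
    (hxN : ∀ t : Fin n, t ∉ A → t ≠ o → t ≠ y → t ≠ z → w s(x, t) = 0)
    (hyN : ∀ t : Fin n, t ∉ A → t ≠ o → t ≠ x → t ≠ z → w s(y, t) = 0)
    (hzN : ∀ t : Fin n, t ∉ A → t ≠ o → t ≠ x → t ≠ y → w s(z, t) = 0)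
    (hkey3 : ∀ a₀ ∈ A, (∀ a ∈ A, (prodBernoulli w).real (openConnIn ({o}ᶜ : Set (Fin n)) a₀ b) ≤
        (prodBernoulli w).real (openConnIn ({o}ᶜ : Set (Fin n)) a b)) →
      (prodBernoulli (fun e : Sym2 (Fin n) => if o ∈ e then (if ∃ p ∈ ({x, y, z} : Finset (Fin n)), e = s(o, p) then 1 else 0) else w e)).real
          (openConn a₀ b) ≤
        (prodBernoulli (fun e : Sym2 (Fin n) => if o ∈ e then (if ∃ p ∈ ({x, y, z} : Finset (Fin n)), e = s(o, p) then 1 else 0) else w e)).real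
            (openConn o b) +
          ∑ W ∈ nullSets A,
            (prodBernoulli (fun e : Sym2 (Fin n) => if o ∈ e then (if ∃ p ∈ ({x, y, z} : Finset (Fin n)), e = s(o, p) then 1 else 0)
              else w e)).real (clusterIs o W) *
            A.inf' hA (fun a' => (prodBernoulli (fun e : Sym2 (Fin n) => if o ∈ e then
              (if ∃ p ∈ ({x, y, z} : Finset (Fin n)), e = s(o, p) then 1 else 0) else w e)).real (openConnIn ((↑W : Set (Fin n))ᶜ) a' b))) :
    KNGood w A hA o b := by
  haveI : ∀ v : Sym2 (Fin n) → unitInterval, IsProbabilityMeasure (prodBernoulli v) := fun v => inferInstance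
  set μ := prodBernoulli w with hμ
  set X : Finset (Fin n) := {x, y, z} with hXdef
  have hoX : o ∉ X := by simp [hXdef, hxo.symm, hyo.symm, hzo.symm]
  -- the witness: the loneliest relay of `G ∖ o`
  obtain ⟨a₀, ha₀, hmin⟩ := A.exists_min_image (fun a => μ.real (openConnIn ({o}ᶜ : Set (Fin n)) a b)) hA
  have ha₀o : a₀ ≠ o := fun h => ho (h ▸ ha₀)
  refine knGood_of_starNeed w A X hA o b ho hoX (fun v hvo hvA hvX => hoN v hvo hvA
    (fun h => hvX (by simp [hXdef, h])) (fun h => hvX (by simp [hXdef, h])) (fun h => hvX (by simp [hXdef, h]))) a₀ ha₀ hmin ?_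
  intro B hBX hBne
  have hoB : o ∉ B := fun h => hoX (hBX h)
  -- the loneliness hypothesis in `G − o` form (loops are invisible)
  set w0 := pinW w {e : Sym2 (Fin n) | o ∈ e ∧ ¬ e.IsDiag} ∅ with hw0
  have hw0r : ∀ a : Fin n, a ≠ o → (prodBernoulli w0).real (openConn a b) = μ.real (openConnIn ({o}ᶜ : Set (Fin n)) a b) := by
    intro a hao
    rw [← restrW_real_openConn w o hao b]
    refine real_openConn_congr_offDiag _ _ (fun f hf => ?_) a b
    induction f using Sym2.ind with
    | h p q =>
      have hpq : p ≠ q := fun h => hf (Sym2.mk_isDiag_iff.2 h)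
      by_cases hof : o ∈ s(p, q)
      · rw [hw0, pinW_apply_of_mem_of_not_mem w (F := {e : Sym2 (Fin n) | o ∈ e ∧ ¬ e.IsDiag}) ⟨hof, hf⟩ (Set.notMem_empty _),
          restrW_apply_of_not_mem]
        intro hm
        obtain ⟨hp, hq, -⟩ := mk_mem_wireSet_iff.1 hm
        rcases Sym2.mem_iff.1 hof with h | h
        · exact (Set.mem_compl_singleton_iff.1 hp) h.symm
        · exact (Set.mem_compl_singleton_iff.1 hq) h.symm
      · rw [hw0, pinW_apply_of_not_mem w ∅ (fun h => hof h.1), restrW_apply_of_mem]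
        refine mk_mem_wireSet_iff.2 ⟨?_, ?_, hpq⟩
        · exact Set.mem_compl_singleton_iff.2 (fun h => hof (h ▸ Sym2.mem_mk_left _ _))
        · exact Set.mem_compl_singleton_iff.2 (fun h => hof (h ▸ Sym2.mem_mk_right _ _))
  have hmin0 : ∀ a ∈ A, (prodBernoulli w0).real (openConn a₀ b) ≤ (prodBernoulli w0).real (openConn a b) := by
    intro a ha
    rw [hw0r a₀ ha₀o, hw0r a (fun h => ho (h ▸ ha))]
    exact hmin a ha
  -- KEY(B): the forced functional of the star `B` at `a₀` is nonnegative
  set WB : Sym2 (Fin n) → unitInterval := fun e => if o ∈ e then (if ∃ p ∈ B, e = s(o, p) then 1 else 0) else w e with hWB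
  have key' : (prodBernoulli WB).real (openConn a₀ b) ≤ (prodBernoulli WB).real (openConn o b) +
      ∑ W ∈ nullSets A, (prodBernoulli WB).real (clusterIs o W) *
        A.inf' hA (fun a' => (prodBernoulli WB).real (openConnIn ((↑W : Set (Fin n))ᶜ) a' b)) := by
    -- enumerate the nonempty subsets of `{x, y, z}`
    have hBcases := subset_three_cases B hBX hBne
    have K1 := fun (x' y' z' : Fin n) (hx' : x' ∉ A) (hy' : y' ∉ A) (hz' : z' ∉ A) (hx'o : x' ≠ o) (hy'o : y' ≠ o) (hz'o : z' ≠ o)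
        (hx'y' : x' ≠ y') (hx'z' : x' ≠ z') (hy'z' : y' ≠ z') (hbx' : b ≠ x') (hby' : b ≠ y') (hbz' : b ≠ z')
        (hx'N : ∀ t : Fin n, t ∉ A → t ≠ o → t ≠ y' → t ≠ z' → w s(x', t) = 0)
        (hy'N : ∀ t : Fin n, t ∉ A → t ≠ o → t ≠ x' → t ≠ z' → w s(y', t) = 0)
        (hz'N : ∀ t : Fin n, t ∉ A → t ≠ o → t ≠ x' → t ≠ y' → w s(z', t) = 0) =>
      forced_key_one w A hA o x' y' z' b a₁ a₂ a₃ a₀ hAeq h12 h13 h23 ho hx' hy' hz' hx'o hy'o hz'o hx'y' hx'z' hy'z' hbo hbx' hby' hbz'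
        ha₀ hx'N hy'N hz'N hmin0
    have K2 := fun (x' y' z' : Fin n) (hx' : x' ∉ A) (hy' : y' ∉ A) (hz' : z' ∉ A) (hx'o : x' ≠ o) (hy'o : y' ≠ o) (hz'o : z' ≠ o)
        (hx'y' : x' ≠ y') (hx'z' : x' ≠ z') (hy'z' : y' ≠ z') (hbx' : b ≠ x') (hby' : b ≠ y') (hbz' : b ≠ z')
        (hx'N : ∀ t : Fin n, t ∉ A → t ≠ o → t ≠ y' → t ≠ z' → w s(x', t) = 0)
        (hy'N : ∀ t : Fin n, t ∉ A → t ≠ o → t ≠ x' → t ≠ z' → w s(y', t) = 0)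
        (hz'N : ∀ t : Fin n, t ∉ A → t ≠ o → t ≠ x' → t ≠ y' → w s(z', t) = 0) =>
      forced_key_two w A hA o x' y' z' b a₁ a₂ a₃ a₀ hAeq h12 h13 h23 ho hx' hy' hz' hx'o hy'o hz'o hx'y' hx'z' hy'z' hbo hbx' hby' hbz'
        ha₀ hx'N hy'N hz'N hmin0
    -- symmetric forms of the pendant hypotheses
    have hxN' : ∀ t : Fin n, t ∉ A → t ≠ o → t ≠ z → t ≠ y → w s(x, t) = 0 := fun t h1 h2 h3 h4 => hxN t h1 h2 h4 h3
    have hyN' : ∀ t : Fin n, t ∉ A → t ≠ o → t ≠ z → t ≠ x → w s(y, t) = 0 := fun t h1 h2 h3 h4 => hyN t h1 h2 h4 h3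
    have hzN' : ∀ t : Fin n, t ∉ A → t ≠ o → t ≠ y → t ≠ x → w s(z, t) = 0 := fun t h1 h2 h3 h4 => hzN t h1 h2 h4 h3
    rcases hBcases with rfl | rfl | rfl | rfl | rfl | rfl | rfl
    · rw [hWB, forced_eq_update_one w o x hloop]
      exact K1 x y z hx hy hz hxo hyo hzo hxy hxz hyz hbx hby hbz hxN hyN hzN
    · rw [hWB, forced_eq_update_one w o y hloop]
      exact K1 y x z hy hx hz hyo hxo hzo (Ne.symm hxy) hyz hxz hby hbx hbz hyN hxN hzN'
    · rw [hWB, forced_eq_update_one w o z hloop]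
      exact K1 z x y hz hx hy hzo hxo hyo (Ne.symm hxz) (Ne.symm hyz) hxy hbz hbx hby hzN hxN' hyN'
    · rw [hWB, forced_eq_update_two w o x y hxo hyo hloop]
      exact K2 x y z hx hy hz hxo hyo hzo hxy hxz hyz hbx hby hbz hxN hyN hzN
    · rw [hWB, forced_eq_update_two w o x z hxo hzo hloop]
      exact K2 x z y hx hz hy hxo hzo hyo hxz hxy (Ne.symm hyz) hbx hbz hby hxN' hzN hyN
    · rw [hWB, forced_eq_update_two w o y z hyo hzo hloop]
      exact K2 y z x hy hz hx hyo hzo hxo hyz (Ne.symm hxy) (Ne.symm hxz) hby hbz hbx hyN' hzN' hxN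
    · exact hkey3 a₀ ha₀ hmin
  -- conditioning on the star is forcing
  have F : ∀ Y : Set (BondConfig (Fin n)), μ.real (Y ∩ starEvent o (↑B : Set (Fin n))) =
      μ.real (starEvent o (↑B : Set (Fin n))) * (prodBernoulli WB).real Y :=
    fun Y => real_inter_starEvent_eq_mul_forced w o B hoB hloop Y
  set c : Finset (Fin n) → ℝ := fun W => A.inf' hA (fun a => μ.real (openConnIn ((↑W : Set (Fin n))ᶜ) a b)) with hc
  set cB : Finset (Fin n) → ℝ := fun W => A.inf' hA (fun a => (prodBernoulli WB).real (openConnIn ((↑W : Set (Fin n))ᶜ) a b)) with hcB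
  have hsum : ∑ W ∈ (nullSets A).erase {o}, μ.real (clusterIs o W ∩ starEvent o (↑B : Set (Fin n))) * c W =
      μ.real (starEvent o (↑B : Set (Fin n))) * ∑ W ∈ (nullSets A).erase {o}, (prodBernoulli WB).real (clusterIs o W) * c W := by
    rw [Finset.mul_sum]
    refine Finset.sum_congr rfl fun W _ => ?_
    rw [F (clusterIs o W)]; ring
  rw [F (openConn a₀ b), F (openConn o b), hsum]
  have hσ : 0 ≤ μ.real (starEvent o (↑B : Set (Fin n))) := measureReal_nonneg
  -- (i) the term `W = {o}` of the forced functional vanishes: `o` has a sure pair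
  obtain ⟨p, hp⟩ := hBne
  have hop : o ≠ p := fun h => hoB (h ▸ hp)
  have hWBp : WB s(o, p) = 1 := by
    simp only [hWB, Sym2.mem_mk_left, if_true]; rw [if_pos ⟨p, hp, rfl⟩]
  have h0 : (prodBernoulli WB).real (clusterIs o ({o} : Finset (Fin n))) = 0 := by
    have hsub : (clusterIs o ({o} : Finset (Fin n)) : Set (BondConfig (Fin n))) ⊆ (openConn o p)ᶜ := by
      intro ω hω hreach
      rw [mem_clusterIs, Finset.coe_singleton] at hω
      have : p ∈ openCluster ω o := hreach
      rw [hω, mem_singleton_iff] at this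
      exact hop this.symm
    have hzz := real_not_openConn_eq_zero_of_surePair WB o p hop hWBp
    exact le_antisymm ((measureReal_mono hsub).trans (le_of_eq hzz)) measureReal_nonneg
  have hmemW : ({o} : Finset (Fin n)) ∈ nullSets A := by
    rw [mem_nullSets, Finset.disjoint_singleton_left]; exact ho
  have hsplit : ∑ W ∈ nullSets A, (prodBernoulli WB).real (clusterIs o W) * cB W =
      ∑ W ∈ (nullSets A).erase {o}, (prodBernoulli WB).real (clusterIs o W) * cB W := by
    rw [← Finset.add_sum_erase _ _ hmemW, h0, zero_mul, zero_add]
  -- (ii) on realizable pockets the forced graph and `G` have the same pocket minima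
  have hterm : ∀ W ∈ (nullSets A).erase {o},
      (prodBernoulli WB).real (clusterIs o W) * cB W ≤ (prodBernoulli WB).real (clusterIs o W) * c W := by
    intro W _
    by_cases hzr : (prodBernoulli WB).real (clusterIs o W) = 0
    · rw [hzr, zero_mul, zero_mul]
    · have hoW : o ∈ W := by
        by_contra hoW
        apply hzr
        have : (clusterIs o W : Set (BondConfig (Fin n))) = ∅ := by
          ext ω
          simp only [mem_empty_iff_false, iff_false]
          intro hω
          rw [mem_clusterIs] at hω
          have : o ∈ (↑W : Set (Fin n)) := by rw [← hω]; exact mem_openCluster_self ω o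
          exact hoW (Finset.mem_coe.1 this)
        rw [this, measureReal_empty]
      have hcc : cB W = c W := by
        simp only [hcB, hc]
        congr 1
        funext a
        refine real_eq_of_agree WB w (((↑W : Set (Fin n))ᶜ).sym2) (fun e he => ?_)
          (DCT16.determinedBy_openConnIn _ a b subset_rfl)
        induction e using Sym2.ind with
        | h p' q' =>
          rw [Set.mk_mem_sym2_iff] at he
          have hoe : o ∉ s(p', q') := by
            intro hm
            rcases Sym2.mem_iff.1 hm with h | h
            · exact he.1 (h ▸ Finset.mem_coe.2 hoW)
            · exact he.2 (h ▸ Finset.mem_coe.2 hoW)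
          simp only [hWB, hoe, if_false]
      rw [hcc]
  have hle : ∑ W ∈ nullSets A, (prodBernoulli WB).real (clusterIs o W) * cB W ≤
      ∑ W ∈ (nullSets A).erase {o}, (prodBernoulli WB).real (clusterIs o W) * c W := by
    rw [hsplit]; exact Finset.sum_le_sum hterm
  have key'' : (prodBernoulli WB).real (openConn a₀ b) ≤ (prodBernoulli WB).real (openConn o b) +
      ∑ W ∈ (nullSets A).erase {o}, (prodBernoulli WB).real (clusterIs o W) * c W := by linarith
  have := mul_le_mul_of_nonneg_left key'' hσ
  rw [mul_add] at this
  exact this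

end KNGoodGMgc

end Summit.CriticalPhenomena.PercolationContinuityZ3.Theorems

end
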